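import Literature.AlgebraicGeometry.VanGeemenVerra2003.QuaternionicPrymWeilClasses
import Literature.AlgebraicGeometry.HodgeTheory.TypeIIIGeneralMemberPowersHodgeConjecture
import HarnessLib

/-!
# The GENERAL quaternionic Prym eightfold: the Hodge conjecture for it and for ALL its powers (van Geemen–Verra 2003, Abdulali 2002)

A COROLLARY of two tree files (`QuaternionicPrymWeilClasses` and `HodgeTheory/TypeIIIGeneralMemberPowersHodgeConjecture`),
conditional BY NAME on three REFEREED named facts of the tree and on the binder "`P` is a GENERAL member"
(`IsGeneralQuaternionType`); a `6`-dimensional locus of eightfolds.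

THE STATEMENT IN PRINT. B. van Geemen, A. Verra, *Quaternionic Pryms and Hodge classes*, Topology **42** (2003)
35–53 (refereed; held `paper:arxiv-math_0103111`), §1 [p0002:L25–L27]: "Results of C. Schoen [S1] on cycles on
Prym varieties imply that the Hodge conjecture holds for the general quaternionic `8`-fold in this family, see
Corollary 4.10"; §4.1 [p0009:L9–L11]: "From Schoen's construction of cycles on Prym varieties and our previous
results, the Hodge conjecture for the general quaternionic Prym studied in this paper then follows"; §4.8
[p0010:L1–L6]: "For a general polarized `2n`-dimensional abelian variety `(A, E)` of quaternion type (i.e.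
`Hod(A)(ℂ) ≅ SO(2n, ℂ)`) one has ([A], Thm 4.1): `Bⁿ(A) ≅ ⟨∧ⁿE⟩ ⊕ W_F`, `Bⁱ(A) = ⟨∧ⁱE⟩ (i ≠ n)`". ALL POWERS:
S. Abdulali, Ann. of Math. (2) **155** (2002) 915–928, Rem. 4.2 [arXiv:math/0410024 p0008:L29]: "if `A` is a
sufficiently general abelian variety of type III, then the Hodge ring of any power of `A` is generated by divisors
and Weil cycles. Using Schoen's results on the algebraicity of certain Weil cycles, it is then possible to prove
the usual Hodge conjecture for all powers of certain type III abelian varieties of dimensions 4, 6, and, 8 (van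
Geemen and Verra [7])" — the dimension-`8` clause is exactly this file.

THIS FILE (theorems only). On the quaternionic Prym eightfold
`P = (ker(𝟙 + (ι²)_*))⁰ ⊂ J(C)` of `QuaternionicPrymWeilClasses` (see its module docstring: `C` of
genus `17` with a free action of the quaternion group `Q = ⟨ι, j⟩`, `ℍ_ℤ = ℤ⟨ι_P, j_P⟩ ⊂ End(P)`, `dim P = 8`, and a
`Q`-invariant rational hyperplane class `h = emb^*l`), the data `(A, φ, χ, n, a, b, h) := (P, ι_P, j_P, 4, 1, 1, h)`
are LITERALLY the data of van Geemen–Verra's §2.1/§4.8 and of the tree's type-III power theorem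
(`HodgeTheory/TypeIIIGeneralMemberPowersHodgeConjecture`): `ι_P² = j_P² = -1`, `ι_P j_P = -j_P ι_P`
(`F = (-1,-1)_ℚ = ℍ_ℚ`, definite), `ι_P^*h = 1·h`, `j_P^*h = 1·h`, `dim P = 2·4`; "general" is the binder
`IsGeneralQuaternionType P ι_P j_P 4 h` ("`Hod(P)(ℂ) ≅ SO(8, ℂ)`", van Geemen–Verra 4.8; by their Thm. 3.6 the
quaternionic Pryms of genus-`3` base fill a component of the `6`-dimensional moduli of polarized abelian eightfolds of
quaternion type with `F = ℍ_ℚ`, so the general quaternionic Prym is general — that identification is NOT typed; the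
binder is carried, exactly as in the sixfold instances of the type-III power file).
* `hodgeConjectureFor_quaternionicPrym_of_general` — **HC(`P`) for the GENERAL quaternionic Prym eightfold**
  (van Geemen–Verra §1 / §4.1 / Cor. 4.10 with 4.8–4.9): the Weil plane `W_{ℚ(ι_P)} = weilClassesOf P ι_P 4 1` is
  algebraic by `weilClassesOf_quaternionicPrym_le_algebraicClasses` at `x = ι_P` (`(p,q,r) = (1,0,0)`), and ONE
  algebraic Weil plane gives HC for a general abelian variety of quaternion type
  (`hodgeConjectureFor_of_isGeneralQuaternionType_of_weilClasses`: vGV 4.8 + Cor. 4.9 + Lefschetz `(1,1)`).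
  Conditional BY NAME on `Schoen1988_cyclicPrym_weilClasses_algebraic_degreeFour` and
  `VanGeemenVerra2003_quaternionHodgeClasses` (both REFEREED).
* `hodgeConjectureFor_powSucc_quaternionicPrym_of_general` — **HC for EVERY POWER `P^{N+1}`** (Abdulali 2002
  Rem. 4.2, dimension `8` = "van Geemen and Verra [7]"), by `hodgeConjectureFor_powSucc_of_isGeneralQuaternionType_of_weilClasses`;
  conditional in addition on `Abdulali1999_hodgeClasses_algebraic_powSucc_of_isGeneralQuaternionType` (IJM 10
  (1999) Thm. 4.1 as invoked in Ann. of Math. 155 §4; REFEREED).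
* `hodgeConjectureFor_powSucc_quaternionicPrym_of_hodgeConjectureFor` — upper bound / sanity: the conclusion
  follows from `HodgeConjectureFor` of every complex abelian variety (each `P^{N+1}` is one).

HYPOTHESES CARRIED, NOT PROVED (as in the parent file, each true for every quaternionic Prym with locator there):
`dim P = 8`, the `Q`-invariant rational hyperplane class, and — new here — GENERALITY (`IsGeneralQuaternionType`).
Known since 2003 (HC(`P`)) / 2002 (all powers, as a remark citing [7]):
the general member of a `6`-dimensional locus of simple type-III eightfolds of Weil type for every `K ⊂ ℍ_ℚ`.

## References

* [vanGeemenVerra2003QuaternionicPryms] B. van Geemen, A. Verra, Topology 42 (2003) 35–53 = arXiv:math/0103111,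
  §1, §4.1, 4.8, Cor. 4.9, Cor. 4.10, Thm. 3.6 (text read: chunks p0002, p0009, p0010).
* [Abdulali2002TypeIII] S. Abdulali, Ann. of Math. (2) 155 (2002) 915–928 = arXiv:math/0410024, §4 Thm. 4.1 and
  Rem. 4.2 (quoted in `TypeIIIGeneralMemberPowersHodgeConjecture`'s docstring, chunk p0008).
* [Abdulali1999TypeIII] S. Abdulali, Internat. J. Math. 10 (1999) 667–675, Thm. 4.1 (p. 673) (not held; restated
  in the two refereed sources above).
* [Schoen1988HodgeWeil] C. Schoen, Compositio Math. 65 (1988) 3–32, Cor. 3.1 at `(q, m, r) = (5, 4, 0)`.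

Provenance: Literature home (namespace `Literature.AlgebraicGeometry.VanGeemenVerra2003.QuaternionicPrym`) of the Summits-side `Theorems/WeilTypeLadderQuaternionicPrymPowers` (b2b cell `hweil` ∕ cell `vhodge`, Weil-type ladder; all its imports are `Literature/` and Mathlib); theorems only, no named fact, no definition — the refereed named facts it uses (`Schoen1988_cyclicPrym_weilClasses_algebraic_degreeFour`, `VanGeemenVerra2003_quaternionHodgeClasses`, …) stay hypotheses BY NAME. Lane `lit-hodgefound` (Layer A2: abelian varieties of Weil ∕ quaternion type), seat p20.
-/

noncomputable section

open _root_.CategoryTheory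
open Literature.AlgebraicGeometry Literature.AlgebraicGeometry.Motives
open Literature.AlgebraicGeometry.HodgeTheory
open Literature.AlgebraicTopology.SingularHomology
open Literature.AlgebraicGeometry.VanGeemenVerra2003

namespace Literature.AlgebraicGeometry.VanGeemenVerra2003.QuaternionicPrym

section QuaternionicPrymPowers

/-- **HC for the GENERAL quaternionic Prym eightfold** (van Geemen–Verra 2003, §1: "the Hodge conjecture holds for
the general quaternionic `8`-fold in this family"; §4.1; Cor. 4.10 with 4.8 and Cor. 4.9). For the Prym
`P = (ker(𝟙 + (ι²)_*))⁰ ⊂ J(C)` of a quaternionic cover (`C` of genus `17`, `Q = ⟨ι, j⟩` acting freely through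
`ι²`), `ℍ_ℤ = ℤ⟨ι_P, j_P⟩ ⊂ End(P)`, `dim P = 8`, a `Q`-invariant rational hyperplane class `h = emb^*l`, and `P`
GENERAL (`IsGeneralQuaternionType P ι_P j_P 4 h`, "`Hod(P)(ℂ) ≅ SO(8, ℂ)`"): every rational `(p,p)` class of `P`
is algebraic. PROOF: the Weil plane `W_{ℚ(ι_P)}` is algebraic (`weilClassesOf_quaternionicPrym_le_algebraicClasses`
at `x = ι_P`, i.e. Schoen 1988 for the free cyclic subgroup `⟨ι⟩`), and one algebraic Weil plane gives HC for a
general abelian variety of quaternion type (`hodgeConjectureFor_of_isGeneralQuaternionType_of_weilClasses`).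
Conditional BY NAME on the two refereed facts; generality, `dim P = 8` and the invariant class are carried.
[cite: vanGeemenVerra2003QuaternionicPryms, §1, §4.1, 4.8, Cor. 4.9 and Cor. 4.10]
[cite: Schoen1988HodgeWeil, Cor 3.1 (p. 24) at (q, m, r) = (5, 4, 0)] -/
theorem hodgeConjectureFor_quaternionicPrym_of_general
    (hS : Literature.AlgebraicGeometry.HodgeTheory.Schoen1988_cyclicPrym_weilClasses_algebraic_degreeFour)
    (hV : VanGeemenVerra2003_quaternionHodgeClasses) :
    ∀ (C : SchemeOver ℂ) (𝒥 : Jacobian C) (ι j : C ⟶ C),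
      IsSmoothProjective 1 C → 𝒥.J.dim = 17 →
      ι ≫ ι ≫ ι ≫ ι = 𝟙 C → j ≫ j = ι ≫ ι → ι ≫ j ≫ ι = j →
      (∀ P : ComplexPoints C, P ≫ (ι ≫ ι) ≠ P) →
    ∀ (e : 𝒥.J ⟶ 𝒥.J), e = 𝒥.pushforward 𝒥 (ι ≫ ι) →
    ∀ (ιP jP : AbelianVariety.kerComponent (𝟙 𝒥.J + e) ⟶ AbelianVariety.kerComponent (𝟙 𝒥.J + e)),
      ιP ≫ AbelianVariety.kerComponentι (𝟙 𝒥.J + e) =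
        AbelianVariety.kerComponentι (𝟙 𝒥.J + e) ≫ 𝒥.pushforward 𝒥 ι →
      jP ≫ AbelianVariety.kerComponentι (𝟙 𝒥.J + e) =
        AbelianVariety.kerComponentι (𝟙 𝒥.J + e) ≫ 𝒥.pushforward 𝒥 j →
      (AbelianVariety.kerComponent (𝟙 𝒥.J + e)).dim = 8 →
    ∀ (emb : ProjectiveEmbedding (AbelianVariety.kerComponent (𝟙 𝒥.J + e)).X)
      (l : complexBetti (projectiveSpace emb.n ℂ) 2), IsRationalClass l → l ≠ 0 →
      complexBetti.map ιP.hom.hom.hom 2 (complexBetti.map emb.ι 2 l) = complexBetti.map emb.ι 2 l →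
      complexBetti.map jP.hom.hom.hom 2 (complexBetti.map emb.ι 2 l) = complexBetti.map emb.ι 2 l →
      IsGeneralQuaternionType (AbelianVariety.kerComponent (𝟙 𝒥.J + e)) ιP jP 4 (complexBetti.map emb.ι 2 l) →
      HodgeConjectureFor (AbelianVariety.kerComponent (𝟙 𝒥.J + e)).dim
        (AbelianVariety.kerComponent (𝟙 𝒥.J + e)).X := by
  intro C 𝒥 ι j hC h17 hι4 hjj hq hfree e he ιP jP hιP hjP hdim emb l hl hl0 hθι hθj hgen
  -- `ℍ_ℤ = ℤ⟨ι_P, j_P⟩` (§2 of the parent file)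
  have hss : 𝒥.pushforward 𝒥 ι ≫ 𝒥.pushforward 𝒥 ι = e := by rw [he, ← Jacobian.pushforward_comp]
  have htt : 𝒥.pushforward 𝒥 j ≫ 𝒥.pushforward 𝒥 j = e := by rw [he, ← Jacobian.pushforward_comp, hjj]
  have hsts : 𝒥.pushforward 𝒥 ι ≫ 𝒥.pushforward 𝒥 j ≫ 𝒥.pushforward 𝒥 ι = 𝒥.pushforward 𝒥 j := by
    rw [← Jacobian.pushforward_comp, ← Jacobian.pushforward_comp, hq]
  have hιP2 : ιP ≫ ιP = -(1 • 𝟙 _) := by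
    rw [one_smul]; exact kerComponent_restrict_comp_self_eq_neg_id hss hιP
  have hjP2 : jP ≫ jP = -(1 • 𝟙 _) := by
    rw [one_smul]; exact kerComponent_restrict_comp_self_eq_neg_id htt hjP
  have hanti : ιP ≫ jP = -(jP ≫ ιP) := kerComponent_restrict_anticomm hss hsts hιP hjP
  -- the polarization data of van Geemen–Verra 2.1 for `(ι_P, j_P)`: `x^*h = (x x̄) h` with `a = b = 1`
  have hθι' : complexBetti.map ιP.hom.hom.hom 2 (complexBetti.map emb.ι 2 l) =
      ((1 : ℕ) : ℂ) • complexBetti.map emb.ι 2 l := by rw [Nat.cast_one, one_smul]; exact hθι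
  have hθj' : complexBetti.map jP.hom.hom.hom 2 (complexBetti.map emb.ι 2 l) =
      ((1 : ℕ) : ℂ) • complexBetti.map emb.ι 2 l := by rw [Nat.cast_one, one_smul]; exact hθj
  -- ONE algebraic Weil plane: `K = ℚ(ι_P) = ℚ(i)`
  have hW : weilClassesOf (AbelianVariety.kerComponent (𝟙 𝒥.J + e)) ιP 4 1 ≤
      algebraicClasses (AbelianVariety.kerComponent (𝟙 𝒥.J + e)).X 4 := by
    have h := weilClassesOf_quaternionicPrym_le_algebraicClasses hS hV C 𝒥 ι j hC h17 hι4 hjj hq hfree e he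
      ιP jP hιP hjP hdim emb l hl hl0 hθι hθj 1 0 0 (Or.inl one_ne_zero) 1 (by norm_num)
    simpa only [one_smul, zero_smul, add_zero] using h
  exact hodgeConjectureFor_of_isGeneralQuaternionType_of_weilClasses hV emb (by norm_num) one_pos one_pos
    (by rw [hdim]) hιP2 hjP2 hanti hl hl0 hθι' hθj' hgen (fun c _ _ hc ↦ hW hc)

/-- **HC for EVERY POWER of the GENERAL quaternionic Prym eightfold** (Abdulali 2002 Rem. 4.2: "the usual Hodge
conjecture for all powers of certain type III abelian varieties of dimensions 4, 6, and, 8 (van Geemen and Verra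
[7])"; mechanism IJM 10 (1999) Thm. 4.1: for a general type-III `A`, HC(`A`) ⟹ HC(`A^{N+1}`)). Same data as
`hodgeConjectureFor_quaternionicPrym_of_general`; conclusion `HodgeConjectureFor` of `P.powSucc N = P^{N+1}` for
every `N`. Conditional BY NAME on the three refereed facts
`Abdulali1999_hodgeClasses_algebraic_powSucc_of_isGeneralQuaternionType`,
`Schoen1988_cyclicPrym_weilClasses_algebraic_degreeFour`, `VanGeemenVerra2003_quaternionHodgeClasses`; generality,
`dim P = 8` and the `Q`-invariant class are carried. The `2 * 4` instance the tree's type-III power file did not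
spell out. [cite: Abdulali2002TypeIII, §4 Rem. 4.2 and proof of Thm. 4.1 (last sentence)]
[cite: Abdulali1999TypeIII, Thm. 4.1 (p. 673)] [cite: vanGeemenVerra2003QuaternionicPryms, 4.8, Cor. 4.9 and Cor. 4.10] -/
theorem hodgeConjectureFor_powSucc_quaternionicPrym_of_general
    (hAbd : Abdulali1999_hodgeClasses_algebraic_powSucc_of_isGeneralQuaternionType)
    (hS : Literature.AlgebraicGeometry.HodgeTheory.Schoen1988_cyclicPrym_weilClasses_algebraic_degreeFour)
    (hV : VanGeemenVerra2003_quaternionHodgeClasses) :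
    ∀ (C : SchemeOver ℂ) (𝒥 : Jacobian C) (ι j : C ⟶ C),
      IsSmoothProjective 1 C → 𝒥.J.dim = 17 →
      ι ≫ ι ≫ ι ≫ ι = 𝟙 C → j ≫ j = ι ≫ ι → ι ≫ j ≫ ι = j →
      (∀ P : ComplexPoints C, P ≫ (ι ≫ ι) ≠ P) →
    ∀ (e : 𝒥.J ⟶ 𝒥.J), e = 𝒥.pushforward 𝒥 (ι ≫ ι) →
    ∀ (ιP jP : AbelianVariety.kerComponent (𝟙 𝒥.J + e) ⟶ AbelianVariety.kerComponent (𝟙 𝒥.J + e)),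
      ιP ≫ AbelianVariety.kerComponentι (𝟙 𝒥.J + e) =
        AbelianVariety.kerComponentι (𝟙 𝒥.J + e) ≫ 𝒥.pushforward 𝒥 ι →
      jP ≫ AbelianVariety.kerComponentι (𝟙 𝒥.J + e) =
        AbelianVariety.kerComponentι (𝟙 𝒥.J + e) ≫ 𝒥.pushforward 𝒥 j →
      (AbelianVariety.kerComponent (𝟙 𝒥.J + e)).dim = 8 →
    ∀ (emb : ProjectiveEmbedding (AbelianVariety.kerComponent (𝟙 𝒥.J + e)).X)
      (l : complexBetti (projectiveSpace emb.n ℂ) 2), IsRationalClass l → l ≠ 0 →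
      complexBetti.map ιP.hom.hom.hom 2 (complexBetti.map emb.ι 2 l) = complexBetti.map emb.ι 2 l →
      complexBetti.map jP.hom.hom.hom 2 (complexBetti.map emb.ι 2 l) = complexBetti.map emb.ι 2 l →
      IsGeneralQuaternionType (AbelianVariety.kerComponent (𝟙 𝒥.J + e)) ιP jP 4 (complexBetti.map emb.ι 2 l) →
      ∀ N : ℕ, HodgeConjectureFor ((AbelianVariety.kerComponent (𝟙 𝒥.J + e)).powSucc N).dim
        ((AbelianVariety.kerComponent (𝟙 𝒥.J + e)).powSucc N).X := by
  intro C 𝒥 ι j hC h17 hι4 hjj hq hfree e he ιP jP hιP hjP hdim emb l hl hl0 hθι hθj hgen N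
  have hss : 𝒥.pushforward 𝒥 ι ≫ 𝒥.pushforward 𝒥 ι = e := by rw [he, ← Jacobian.pushforward_comp]
  have htt : 𝒥.pushforward 𝒥 j ≫ 𝒥.pushforward 𝒥 j = e := by rw [he, ← Jacobian.pushforward_comp, hjj]
  have hsts : 𝒥.pushforward 𝒥 ι ≫ 𝒥.pushforward 𝒥 j ≫ 𝒥.pushforward 𝒥 ι = 𝒥.pushforward 𝒥 j := by
    rw [← Jacobian.pushforward_comp, ← Jacobian.pushforward_comp, hq]
  have hιP2 : ιP ≫ ιP = -(1 • 𝟙 _) := by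
    rw [one_smul]; exact kerComponent_restrict_comp_self_eq_neg_id hss hιP
  have hjP2 : jP ≫ jP = -(1 • 𝟙 _) := by
    rw [one_smul]; exact kerComponent_restrict_comp_self_eq_neg_id htt hjP
  have hanti : ιP ≫ jP = -(jP ≫ ιP) := kerComponent_restrict_anticomm hss hsts hιP hjP
  have hθι' : complexBetti.map ιP.hom.hom.hom 2 (complexBetti.map emb.ι 2 l) =
      ((1 : ℕ) : ℂ) • complexBetti.map emb.ι 2 l := by rw [Nat.cast_one, one_smul]; exact hθι
  have hθj' : complexBetti.map jP.hom.hom.hom 2 (complexBetti.map emb.ι 2 l) =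
      ((1 : ℕ) : ℂ) • complexBetti.map emb.ι 2 l := by rw [Nat.cast_one, one_smul]; exact hθj
  have hW : weilClassesOf (AbelianVariety.kerComponent (𝟙 𝒥.J + e)) ιP 4 1 ≤
      algebraicClasses (AbelianVariety.kerComponent (𝟙 𝒥.J + e)).X 4 := by
    have h := weilClassesOf_quaternionicPrym_le_algebraicClasses hS hV C 𝒥 ι j hC h17 hι4 hjj hq hfree e he
      ιP jP hιP hjP hdim emb l hl hl0 hθι hθj 1 0 0 (Or.inl one_ne_zero) 1 (by norm_num)
    simpa only [one_smul, zero_smul, add_zero] using h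
  exact hodgeConjectureFor_powSucc_of_isGeneralQuaternionType_of_weilClasses hAbd hV emb (by norm_num) one_pos
    one_pos (by rw [hdim]) hιP2 hjP2 hanti hl hl0 hθι' hθj' hgen (fun c _ _ hc ↦ hW hc) N

/-- Upper bound / sanity: the conclusion of `hodgeConjectureFor_powSucc_quaternionicPrym_of_general` follows from
`HodgeConjectureFor` of every complex abelian variety (each power `P^{N+1}` is one) — nothing stronger than the
summit is claimed. [cite: Deligne2000, §1] -/
theorem hodgeConjectureFor_powSucc_quaternionicPrym_of_hodgeConjectureFor
    (h : ∀ B : AbelianVariety ℂ, HodgeConjectureFor B.dim B.X)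
    {J : AbelianVariety ℂ} (e : J ⟶ J) (N : ℕ) :
    HodgeConjectureFor ((AbelianVariety.kerComponent (𝟙 J + e)).powSucc N).dim
      ((AbelianVariety.kerComponent (𝟙 J + e)).powSucc N).X :=
  h _

end QuaternionicPrymPowers

end Literature.AlgebraicGeometry.VanGeemenVerra2003.QuaternionicPrym

end
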